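import Summits.ResolutionOfSingularities.ResolutionOfSingularities.Theorems.WeightedInvariantELadderOneTrivialEndRing
import Summits.ResolutionOfSingularities.ResolutionOfSingularities.Theorems.WeightedInvariantELadderOneMeasure
import Summits.ResolutionOfSingularities.ResolutionOfSingularities.Theorems.WeightedInvariantDatumToEmbeddedStrictTransformCharts
import Summits.ResolutionOfSingularities.ResolutionOfSingularities.Theorems.WeightedInvariantWeightedThesisGlobalCobordantPlus
import Literature.AlgebraicGeometry.Resolution.AlterationsSingularComponents
import Literature.AlgebraicGeometry.Resolution.PointBlowupHsFunMono
import Literature.AlgebraicGeometry.Resolution.StalkIdealLemmas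
import HarnessLib

/-!
# Rung `e = 1` of the door: singular points of the strict transform lie over the support of the centre

Route `ResolutionOfSingularities/WeightedInvariant`, door crux `HypersurfaceCentreConstruction`
(stmt-ResolutionOfSingularities-19897), e-ladder line of `res-L1-w43-stub-10`; helper (M5) toward the stub
`stub_e1_inv_succ` (res-type-017).  GEOMETRY (Włodarczyk, arXiv:2203.03090, Def. 2.3.5: away from the vertex
and the exceptional divisor the cobordant blow-up is the trivial cobordism `B₋ = Y × 𝔾ₘ`, on which the strict
transform of `V(K)` is `V(K) × 𝔾ₘ`): a point of the strict transform `V(σˢK) ⊆ B₊` lying over a point of `Y`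
that is OFF the support of the Rees algebra and OFF `singImage K` is a regular point
(`isRegularLocalRing_stalk_strictTransformPlus_of_not_mem`); hence
`singImage (σˢK) ⊆ σ₊⁻¹ (supp R ∪ singImage K)` (`singImage_strictTransformPlus_subset`), and for an admissible
centre of a stage of the e-ladder (`supp R = singImage (ker i)`) every maximal singular point of the successor
lies over `singImage (ker i)` (`Stage.πPlus_mem_singImage_of_mem_singImage_succ`).

Proof: `𝒪_{V(σˢK),x'} = 𝒪_{B,b}/σˢ_b` (closed subscheme, open `B₊ ⊆ B`), read on the chart `Spec ⊕ₙ 𝒥ₙ(U) tⁿ` of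
`B` over an affine `U ∋ y` (`StrictTransform.iSup_colon_ideal_chart`: the sections of `σˢK` are the
`t⁻¹`-saturation of `K(U)·⊕ 𝒥ₙ(U) tⁿ`) as `S_Q/σS_Q`, `S = Γ(U)[t⁻¹, 𝒥ₙ tⁿ]`; off the support some `a ∈ 𝒥ₙ(U)` is a
unit at `y`, so `t⁻¹ ∉ Q`, and the ring-level theorem
`TrivialEnd.isRegularLocalRing_localization_quotient_saturation` applies with `Γ(U)_p/K(U)Γ(U)_p = 𝒪_{Y,y}/K_y`
regular.

Nothing here is a claim about Hironaka's problem; AI-written, weaker than expert review.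
-/

noncomputable section

set_option linter.dupNamespace false -- mandated namespace of this single-conjunct summit
-- `Γ(Y, U)` versus `Y.presheaf.obj (op U)` inside `rw` motives and instance problems:
set_option backward.isDefEq.respectTransparency false

open scoped LaurentPolynomial
open LaurentPolynomial CategoryTheory AlgebraicGeometry TopologicalSpace IsLocalRing
open Literature.AlgebraicGeometry.Resolution
open Summit.ResolutionOfSingularities.ResolutionOfSingularities.Theorems
open Summit.ResolutionOfSingularities.ResolutionOfSingularities.Cruxes.HypersurfaceCentreConstruction.LocalEngine
  (mem_support_of_mem_singImage mem_singImage_iff_not_isRegularLocalRing_quotient mem_basicOpen_iff_not_mem)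

namespace Summit.ResolutionOfSingularities.ResolutionOfSingularities.Theorems.ELadderOne

universe u

/-! ## Quotient stalks along morphisms with isomorphic stalk maps -/

/-- For a morphism `f` whose stalk map at `x` is an isomorphism (e.g. an open immersion), regularity of
`𝒪_{X,x}/(f⁻¹K)_x` is regularity of `𝒪_{Y,f x}/K_{f x}`. [folklore] -/
theorem isRegularLocalRing_quotient_stalkIdeal_comap_iff {X Y : Scheme.{u}} (f : X ⟶ Y)
    (K : Y.IdealSheafData) (x : X) [IsIso (f.stalkMap x)] :
    IsRegularLocalRing (X.presheaf.stalk x ⧸ stalkIdeal (K.comap f) x) ↔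
      IsRegularLocalRing (Y.presheaf.stalk (f x) ⧸ stalkIdeal K (f x)) := by
  let e : Y.presheaf.stalk (f x) ≃+* X.presheaf.stalk x := (asIso (f.stalkMap x)).commRingCatIsoToRingEquiv
  have hmap : stalkIdeal (K.comap f) x = (stalkIdeal K (f x)).map (e : _ →+* _) :=
    stalkIdeal_comap_eq_map_stalkMap f K x
  let e' : (Y.presheaf.stalk (f x) ⧸ stalkIdeal K (f x)) ≃+* (X.presheaf.stalk x ⧸ stalkIdeal (K.comap f) x) :=
    Ideal.quotientEquiv _ _ e hmap
  exact ⟨fun h => @IsRegularLocalRing.of_ringEquiv _ _ h _ _ e'.symm,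
    fun h => @IsRegularLocalRing.of_ringEquiv _ _ h _ _ e'⟩

/-! ## Transport of localizations along a pair of inverse ring homomorphisms -/

/-- Along mutually inverse ring homomorphisms `R ⇄ S`, an extended ideal along the inverse is the contracted
ideal along the map. [folklore] -/
theorem map_eq_comap_of_inverse {R S : Type*} [CommRing R] [CommRing S] (ehom : R →+* S) (einv : S →+* R)
    (hhi : ∀ r, einv (ehom r) = r) (hih : ∀ s, ehom (einv s) = s) (J : Ideal S) :
    J.map einv = J.comap ehom := by
  apply le_antisymm
  · rw [Ideal.map_le_iff_le_comap]
    intro s hs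
    rw [Ideal.mem_comap, Ideal.mem_comap, hih]
    exact hs
  · intro r hr
    rw [Ideal.mem_comap] at hr
    rw [← hhi r]
    exact Ideal.mem_map_of_mem _ hr

/-- **A localization of `R` at a prime `P` is a localization of `S` at the corresponding prime**, along mutually
inverse ring homomorphisms `R ⇄ S` (the `S`-algebra structure being the composite with the inverse). [folklore] -/
theorem isLocalization_atPrime_of_inverse {R S : Type*} [CommRing R] [CommRing S] (ehom : R →+* S)
    (einv : S →+* R) (hhi : ∀ r, einv (ehom r) = r) (hih : ∀ s, ehom (einv s) = s)
    (P : Ideal R) [P.IsPrime] (Q : Ideal S) [Q.IsPrime] (hQ : P.comap einv = Q)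
    (Rp : Type*) [CommRing Rp] [Algebra R Rp] [IsLocalization.AtPrime Rp P] :
    @IsLocalization.AtPrime S _ Rp _ ((algebraMap R Rp).comp einv).toAlgebra Q _ := by
  letI : Algebra S Rp := ((algebraMap R Rp).comp einv).toAlgebra
  have halg : ∀ s, algebraMap S Rp s = algebraMap R Rp (einv s) := fun _ => rfl
  have hmemQ : ∀ s, s ∈ Q ↔ einv s ∈ P := fun s => by rw [← hQ, Ideal.mem_comap]
  have hinj : Function.Injective einv := fun x y hxy => by simpa only [hih] using congrArg ehom hxy
  refine (isLocalization_iff Q.primeCompl Rp).mpr ⟨?_, ?_, ?_⟩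
  · rintro ⟨s, hs⟩
    rw [halg]
    exact IsLocalization.map_units Rp (⟨einv s, fun h => hs ((hmemQ s).mpr h)⟩ : P.primeCompl)
  · intro z
    obtain ⟨⟨r, u⟩, hz⟩ := IsLocalization.surj P.primeCompl z
    have hu' : (u : R) ∉ P := u.2
    have hu : ehom (u : R) ∉ Q := fun h => hu' (by simpa only [hmemQ, hhi] using h)
    refine ⟨⟨ehom r, ⟨ehom u, hu⟩⟩, ?_⟩
    simp only [halg, hhi]
    exact hz
  · intro s₁ s₂ h12
    rw [halg, halg] at h12
    obtain ⟨⟨c, hc⟩, hc12⟩ := IsLocalization.exists_of_eq (M := P.primeCompl) h12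
    have hc0 : c ∉ P := hc
    have hc' : ehom c ∉ Q := fun h => hc0 (by simpa only [hmemQ, hhi] using h)
    refine ⟨⟨ehom c, hc'⟩, hinj ?_⟩
    simp only [map_mul, hhi]
    exact hc12

/-! ## Off the support and off `singImage K`, the strict transform is regular -/

section Chart

variable {Y B : Scheme.{0}} [IsLocallyNoetherian Y] [IsLocallyNoetherian B] (π : B ⟶ Y)
  (τ : B ⟶ Spec (CommRingCat.of (Polynomial ReesFiltration.ZZ.{0})))
  (R' : ReesFiltration Y) (K : Y.IdealSheafData) (U : Y.affineOpens)
  (φ : Spec (CommRingCat.of (R'.sectionsRing U)) ⟶ B) [IsOpenImmersion φ]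
  (hφπ : φ ≫ π =
    Spec.map (CommRingCat.ofHom (algebraMap Γ(Y, U) (R'.sectionsRing U))) ≫ U.2.fromSpec)
  (hφA : φ ≫ τ = Spec.map (CommRingCat.ofHom (R'.polyToSections U)))

omit [IsLocallyNoetherian Y] in
include hφπ hφA in
set_option maxHeartbeats 1600000 in -- one-time transport `Γ(B, φ(⊤)) ≅ ⊕ 𝒥ₙ(U) tⁿ` (instance paths on the sections ring)
/-- **The chart identification as plain ring maps.**  Mutually inverse ring homomorphisms
`Γ(B, φ(Spec ⊕ 𝒥ₙ(U) tⁿ)) ⇄ ⊕ 𝒥ₙ(U) tⁿ` (from `φ.appIso ⊤` and `ΓSpecIso`) under which the sections of the strict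
transform `⋃ₙ (π^*K : τ^*(x)ⁿ)` are the `t⁻¹`-saturation of `K(U)·⊕ 𝒥ₙ(U) tⁿ`
(`StrictTransform.iSup_colon_ideal_chart`) and `π♯` is the structure map (`StrictTransform.appLE_comp_appIso_hom`).
[folklore] -/
theorem exists_chart_ringHom :
    ∃ (ehom : Γ(B, φ ''ᵁ ⊤) →+* R'.sectionsRing U) (einv : R'.sectionsRing U →+* Γ(B, φ ''ᵁ ⊤)),
      (∀ r, einv (ehom r) = r) ∧ (∀ s, ehom (einv s) = s) ∧
      (⨆ n : ℕ, colon (K.comap π) ((affineBlowup.idealSheaf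
          (Ideal.span {(Polynomial.X : Polynomial ReesFiltration.ZZ.{0})})).comap τ ^ n)).ideal
          ⟨φ ''ᵁ ⊤, (isAffineOpen_top _).image_of_isOpenImmersion φ⟩ =
        Ideal.comap ehom (⨆ n : ℕ, ((K.ideal U).map (algebraMap Γ(Y, U) (R'.sectionsRing U))).colon
          ((Ideal.span {(⟨T (-1), (R'.filtration U).T_neg_one_mem_extendedRees⟩ : R'.sectionsRing U)} ^ n :
            Ideal (R'.sectionsRing U)) : Set (R'.sectionsRing U))) ∧
      ehom.comp (π.appLE U (φ ''ᵁ ⊤)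
          (DatumToEmbedded.StrictTransform.image_top_le_preimage π R' U φ hφπ)).hom =
        algebraMap Γ(Y, U) (R'.sectionsRing U) := by
  let iso : Γ(B, φ ''ᵁ ⊤) ≅ CommRingCat.of (R'.sectionsRing U) :=
    (φ.appIso ⊤) ≪≫ Scheme.ΓSpecIso (CommRingCat.of (R'.sectionsRing U))
  have hhi : ∀ r, iso.inv.hom (iso.hom.hom r) = r := fun r => by
    have h := congrArg (fun f : Γ(B, φ ''ᵁ ⊤) ⟶ Γ(B, φ ''ᵁ ⊤) => f.hom r) iso.hom_inv_id
    simpa only [CommRingCat.hom_comp, RingHom.comp_apply, CommRingCat.hom_id, RingHom.id_apply] using h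
  have hih : ∀ s, iso.hom.hom (iso.inv.hom s) = s := fun s => by
    have h := congrArg (fun f : CommRingCat.of (R'.sectionsRing U) ⟶ CommRingCat.of (R'.sectionsRing U) =>
      f.hom s) iso.inv_hom_id
    simpa only [CommRingCat.hom_comp, RingHom.comp_apply, CommRingCat.hom_id, RingHom.id_apply] using h
  have hstr : (π.appLE U (φ ''ᵁ ⊤) (DatumToEmbedded.StrictTransform.image_top_le_preimage π R' U φ hφπ) ≫
      (φ.appIso ⊤).hom ≫ (Scheme.ΓSpecIso (CommRingCat.of (R'.sectionsRing U))).hom).hom =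
      algebraMap Γ(Y, U) (R'.sectionsRing U) := by
    rw [DatumToEmbedded.StrictTransform.appLE_comp_appIso_hom π R' U φ hφπ]
    rfl
  refine ⟨iso.hom.hom, iso.inv.hom, hhi, hih,
    DatumToEmbedded.StrictTransform.iSup_colon_ideal_chart π τ R' U φ hφπ hφA K, ?_⟩
  rw [← hstr, CommRingCat.hom_comp]
  rfl

include hφπ hφA in
set_option maxHeartbeats 800000 in -- chart bookkeeping: stalks, two affine dictionaries
/-- **Chart form.**  `B` a locally Noetherian scheme over `Y` and `𝔸¹` (`π`, `τ = t⁻¹`), `φ` the chart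
`Spec ⊕ₙ 𝒥ₙ(U) tⁿ ⟶ B` over an affine `U` compatible with `π` and `t⁻¹` (for the full cobordant blow-up: `R'.π`,
`R'.toA1`, `R'.openCover.f U`), `σ = ⋃ₙ (π^*K : τ^*(x)ⁿ)` the strict transform.  At a point `b` of the chart in the
support of `σ`, lying over a point of `U` at which some positive piece `𝒥ₙ` is the unit ideal and `V(K)` is regular,
the quotient stalk `𝒪_{B,b}/σ_b` is a regular local ring. [cite: Wlodarczyk2022, Def. 2.3.5 and 3.3.12] -/
theorem isRegularLocalRing_quotient_stalkIdeal_strictTransform_chart (b : B) (hbW : b ∈ φ ''ᵁ ⊤)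
    (hbsupp : b ∈ ((⨆ n : ℕ, colon (K.comap π) ((affineBlowup.idealSheaf
        (Ideal.span {(Polynomial.X : Polynomial ReesFiltration.ZZ.{0})})).comap τ ^ n)).support : Set B))
    (hoff : ∃ n : ℕ, 0 < n ∧ π b ∉ ((R'.ideal n).support : Set Y))
    (hreg : π b ∉ singImage K) :
    IsRegularLocalRing (B.presheaf.stalk b ⧸ stalkIdeal (⨆ n : ℕ, colon (K.comap π) ((affineBlowup.idealSheaf
        (Ideal.span {(Polynomial.X : Polynomial ReesFiltration.ZZ.{0})})).comap τ ^ n)) b) := by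
  have hyU : π b ∈ (U : Y.Opens) := DatumToEmbedded.StrictTransform.image_top_le_preimage π R' U φ hφπ hbW
  -- `y = π b ∈ supp K` (the total transform lies in the strict transform)
  have hysupp : π b ∈ (K.support : Set Y) := by
    have hle0 : K.comap π ≤ ⨆ n : ℕ, colon (K.comap π) ((affineBlowup.idealSheaf
        (Ideal.span {(Polynomial.X : Polynomial ReesFiltration.ZZ.{0})})).comap τ ^ n) := by
      refine le_trans ?_ (le_iSup (fun n : ℕ => colon (K.comap π) ((affineBlowup.idealSheaf
        (Ideal.span {(Polynomial.X : Polynomial ReesFiltration.ZZ.{0})})).comap τ ^ n)) 0)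
      rw [pow_zero, Scheme.IdealSheafData.one_eq_top, colon_top]
    have h : b ∈ ((K.comap π).support : Set B) := Scheme.IdealSheafData.support_antitone hle0 hbsupp
    rw [Scheme.IdealSheafData.support_comap] at h
    exact h
  have hW : IsAffineOpen (φ ''ᵁ ⊤) := (isAffineOpen_top _).image_of_isOpenImmersion φ
  have hWU : φ ''ᵁ ⊤ ≤ π ⁻¹ᵁ U := DatumToEmbedded.StrictTransform.image_top_le_preimage π R' U φ hφπ
  -- Step 2: the affine dictionary on `B` at `b ∈ W` (prime `𝔭_b = hW.primeIdealOf ⟨b, hbW⟩` of `Γ(B, W)`);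
  -- all destructuring happens before the goal is rewritten (`rcases` motives on the rewritten goal are costly)
  have hdict := isRegularLocalRing_quotient_stalkIdeal_iff_of_isAffineOpen
    (⨆ n : ℕ, colon (K.comap π) ((affineBlowup.idealSheaf
        (Ideal.span {(Polynomial.X : Polynomial ReesFiltration.ZZ.{0})})).comap τ ^ n)) hW hbW hbsupp
  have hle := hdict.1
  -- Step 3: the chart identification `Γ(B, W) ⇄ S = ⊕ 𝒥ₙ(U) tⁿ` as plain ring maps
  let t : R'.sectionsRing U := ⟨T (-1), (R'.filtration U).T_neg_one_mem_extendedRees⟩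
  obtain ⟨ehom, einv, hhi, hih, hsec, hstr⟩ := exists_chart_ringHom π τ R' K U φ hφπ hφA
  -- Step 4: the prime `Q = e(𝔭_b)` of `S` and its contraction to `Γ(Y, U)`
  obtain ⟨Q, hQ⟩ : ∃ Q : Ideal (R'.sectionsRing U),
      (hW.primeIdealOf ⟨b, hbW⟩).asIdeal.comap einv = Q := ⟨_, rfl⟩
  have hmemQ : ∀ s, s ∈ Q ↔ einv s ∈ (hW.primeIdealOf ⟨b, hbW⟩).asIdeal := fun s => by
    rw [← hQ, Ideal.mem_comap]
  haveI hQp : Q.IsPrime := by rw [← hQ]; infer_instance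
  have hQA : Q.comap (algebraMap Γ(Y, U) (R'.sectionsRing U)) = (U.2.primeIdealOf ⟨π b, hyU⟩).asIdeal := by
    have h4 : einv.comp (algebraMap Γ(Y, U) (R'.sectionsRing U)) = (π.appLE U (φ ''ᵁ ⊤) hWU).hom := by
      rw [← hstr, ← RingHom.comp_assoc]
      ext r
      simp only [RingHom.comp_apply, hhi]
    rw [← hQ, Ideal.comap_comap, h4]
    exact congrArg PrimeSpectrum.asIdeal (IsAffineOpen.comap_primeIdealOf_appLE U.1 U.2 (φ ''ᵁ ⊤) hW hWU hbW)
  -- `t⁻¹ ∉ Q`: some `a ∈ 𝒥ₙ(U)`, `n > 0`, is a unit at `y`, and `a = (a tⁿ) · (t⁻¹)ⁿ` in `S`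
  have htQ : t ∉ Q := by
    obtain ⟨n, hn, hnot⟩ := hoff
    rw [SetLike.mem_coe, Scheme.IdealSheafData.mem_support_iff_of_mem (I := R'.ideal n) (U := U) hyU,
      Scheme.mem_zeroLocus_iff] at hnot
    push Not at hnot
    obtain ⟨a, ha, hya⟩ := hnot
    have hya' : a ∉ (U.2.primeIdealOf ⟨π b, hyU⟩).asIdeal :=
      (mem_basicOpen_iff_not_mem (U := U) (hy := hyU) a).mp hya
    intro htQ'
    apply hya'
    rw [← hQA, Ideal.mem_comap]
    have haT : (⟨LaurentPolynomial.C a * T (n : ℤ),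
        ((R'.filtration U).C_mul_T_mem_extendedRees_iff).mpr ha⟩ : R'.sectionsRing U) * t ^ n =
        algebraMap Γ(Y, U) (R'.sectionsRing U) a := by
      apply Subtype.ext
      change LaurentPolynomial.C a * T (n : ℤ) * T (-1) ^ n = LaurentPolynomial.C a
      rw [T_pow, mul_assoc, ← T_add]
      simp
    rw [← haT]
    exact Q.mul_mem_left _ (Q.pow_mem_of_mem htQ' n hn)
  -- `K(U)·S ⊆ Q`: `σ(W) ⊆ 𝔭_b` since `b ∈ supp σ`
  have h𝔞Q : (K.ideal U).map (algebraMap Γ(Y, U) (R'.sectionsRing U)) ≤ Q := by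
    have h1 : Ideal.comap ehom (⨆ n : ℕ,
        ((K.ideal U).map (algebraMap Γ(Y, U) (R'.sectionsRing U))).colon
          ((Ideal.span {t} ^ n : Ideal (R'.sectionsRing U)) : Set (R'.sectionsRing U)))
        ≤ (hW.primeIdealOf ⟨b, hbW⟩).asIdeal := hsec ▸ hle
    have h2 : (⨆ n : ℕ, ((K.ideal U).map (algebraMap Γ(Y, U) (R'.sectionsRing U))).colon
          ((Ideal.span {t} ^ n : Ideal (R'.sectionsRing U)) : Set (R'.sectionsRing U))) ≤ Q := by
      intro s hs
      rw [hmemQ]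
      apply h1
      rw [Ideal.mem_comap, hih]
      exact hs
    refine le_trans (fun s hs => ?_) h2
    refine Submodule.mem_iSup_of_mem 0 ?_
    rw [pow_zero, Ideal.one_eq_top, Submodule.mem_colon]
    intro r _
    rw [smul_eq_mul]
    exact Ideal.mul_mem_right r _ hs
  -- Step 5: `𝒪_{Y,y}/K_y = Γ(Y,U)_{p_y}/K(U)Γ(Y,U)_{p_y}` is regular
  have hregY : IsRegularLocalRing (Localization.AtPrime (U.2.primeIdealOf ⟨π b, hyU⟩).asIdeal ⧸
      (K.ideal U).map (algebraMap Γ(Y, U) (Localization.AtPrime (U.2.primeIdealOf ⟨π b, hyU⟩).asIdeal))) := by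
    rw [← (isRegularLocalRing_quotient_stalkIdeal_iff_of_isAffineOpen K U.2 hyU hysupp).2]
    by_contra hnot
    exact hreg ((mem_singImage_iff_not_isRegularLocalRing_quotient K hysupp).mpr hnot)
  -- Step 6: `Γ(B, W)_{𝔭_b}` is a localization of `S` at `Q` along the chart identification
  letI algS : Algebra (R'.sectionsRing U) (Localization.AtPrime (hW.primeIdealOf ⟨b, hbW⟩).asIdeal) :=
    ((algebraMap Γ(B, φ ''ᵁ ⊤) (Localization.AtPrime (hW.primeIdealOf ⟨b, hbW⟩).asIdeal)).comp einv).toAlgebra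
  haveI : IsLocalization.AtPrime (Localization.AtPrime (hW.primeIdealOf ⟨b, hbW⟩).asIdeal) Q :=
    isLocalization_atPrime_of_inverse ehom einv hhi hih (hW.primeIdealOf ⟨b, hbW⟩).asIdeal Q hQ
      (Localization.AtPrime (hW.primeIdealOf ⟨b, hbW⟩).asIdeal)
  -- Step 7: the ring-level theorem, and `Sat · Γ(B,W)_𝔭 = σ(W) · Γ(B,W)_𝔭` along the chart identification
  haveI : IsNoetherianRing Γ(Y, U) := IsLocallyNoetherian.component_noetherian U
  have key := TrivialEnd.isRegularLocalRing_localization_quotient_saturation (R'.filtration U) t rfl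
    (K.ideal U) Q htQ h𝔞Q hQA hregY (Localization.AtPrime (hW.primeIdealOf ⟨b, hbW⟩).asIdeal)
  have hmapinv := map_eq_comap_of_inverse ehom einv hhi hih
    (⨆ n : ℕ, ((K.ideal U).map (algebraMap Γ(Y, U) (R'.sectionsRing U))).colon
      ((Ideal.span {t} ^ n : Ideal (R'.sectionsRing U)) : Set (R'.sectionsRing U)))
  have hideal : Ideal.map ((algebraMap Γ(B, φ ''ᵁ ⊤) (Localization.AtPrime (hW.primeIdealOf ⟨b, hbW⟩).asIdeal)).comp einv)
      (⨆ n : ℕ, ((K.ideal U).map (algebraMap Γ(Y, U) (R'.sectionsRing U))).colon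
          ((Ideal.span {t} ^ n : Ideal (R'.sectionsRing U)) : Set (R'.sectionsRing U))) =
      Ideal.map (algebraMap Γ(B, φ ''ᵁ ⊤) (Localization.AtPrime (hW.primeIdealOf ⟨b, hbW⟩).asIdeal))
        ((⨆ n : ℕ, colon (K.comap π) ((affineBlowup.idealSheaf
          (Ideal.span {(Polynomial.X : Polynomial ReesFiltration.ZZ.{0})})).comap τ ^ n)).ideal ⟨_, hW⟩) :=
    ((Ideal.map_map einv (algebraMap Γ(B, φ ''ᵁ ⊤)
      (Localization.AtPrime (hW.primeIdealOf ⟨b, hbW⟩).asIdeal))).symm.trans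
      (congrArg (Ideal.map (algebraMap Γ(B, φ ''ᵁ ⊤)
        (Localization.AtPrime (hW.primeIdealOf ⟨b, hbW⟩).asIdeal))) hmapinv)).trans
      (congrArg (Ideal.map (algebraMap Γ(B, φ ''ᵁ ⊤)
        (Localization.AtPrime (hW.primeIdealOf ⟨b, hbW⟩).asIdeal))) hsec).symm
  exact hdict.2.mpr (@IsRegularLocalRing.of_ringEquiv _ _ key _ _ (Ideal.quotEquivOfEq hideal))

end Chart

/-- **A point of the strict transform over a point off the support of the Rees algebra and off `singImage K` is
regular.**  `Y` locally Noetherian, `R'` a Rees filtration on `Y` with locally Noetherian full cobordant blow-up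
`B`, `K` an ideal sheaf on `Y`, `x'` a point of `V(σˢK|_{B₊})` over `y ∈ Y`; if some positive piece `𝒥ₙ` is the
unit ideal at `y` and `V(K)` is regular over `y`, then `V(σˢK)` is regular at `x'` (the trivial end
`B₋ = Y × 𝔾ₘ` of the cobordism). [cite: Wlodarczyk2022, Def. 2.3.5 and 3.3.12] -/
theorem isRegularLocalRing_stalk_strictTransformPlus_of_not_mem {Y : Scheme.{0}} [IsLocallyNoetherian Y]
    (R' : ReesFiltration Y) [IsLocallyNoetherian R'.cobordantBlowup] (K : Y.IdealSheafData)
    (x' : (R'.strictTransformPlus K).subscheme)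
    (hoff : ∃ n : ℕ, 0 < n ∧
      R'.πPlus ((R'.strictTransformPlus K).subschemeι x') ∉ ((R'.ideal n).support : Set Y))
    (hreg : R'.πPlus ((R'.strictTransformPlus K).subschemeι x') ∉ singImage K) :
    IsRegularLocalRing ((R'.strictTransformPlus K).subscheme.presheaf.stalk x') := by
  -- closed subscheme ⇒ quotient stalk on `B₊`; open `B₊ ⊆ B` ⇒ quotient stalk on `B` at `b`
  rw [isRegularLocalRing_stalk_subscheme_iff]
  haveI : IsIso (R'.plus.ι.stalkMap ((R'.strictTransformPlus K).subschemeι.base x')) :=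
    (IsOpenImmersion.iff_isIso_stalkMap.mp inferInstance).2 _
  refine (isRegularLocalRing_quotient_stalkIdeal_comap_iff R'.plus.ι (R'.strictTransform K)
    ((R'.strictTransformPlus K).subschemeι.base x')).mpr ?_
  obtain ⟨b, hb⟩ : ∃ b : R'.cobordantBlowup,
      R'.plus.ι ((R'.strictTransformPlus K).subschemeι.base x') = b := ⟨_, rfl⟩
  have hπb : R'.πPlus ((R'.strictTransformPlus K).subschemeι x') = R'.π b := by rw [← hb]; rfl
  rw [hπb] at hoff hreg
  rw [hb]
  -- `b ∈ supp σˢK`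
  have hbsupp : b ∈ ((R'.strictTransform K).support : Set R'.cobordantBlowup) := by
    have h1 : (R'.strictTransformPlus K).subschemeι.base x' ∈
        ((R'.strictTransformPlus K).support : Set (R'.plus : Scheme.{0})) := by
      rw [← Scheme.IdealSheafData.range_subschemeι]
      exact ⟨x', rfl⟩
    have h2 : (R'.strictTransformPlus K).subschemeι.base x' ∈
        (((R'.strictTransform K).comap R'.plus.ι).support : Set (R'.plus : Scheme.{0})) := h1
    rw [Scheme.IdealSheafData.support_comap] at h2
    rw [← hb]
    exact h2
  -- an affine `U ∋ y` and the chart `Spec ⊕ 𝒥ₙ(U) tⁿ ⟶ B` over it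
  obtain ⟨U, hU, hyU, -⟩ :=
    exists_isAffineOpen_mem_and_subset (X := Y) (x := R'.π b) (U := ⊤) (Opens.mem_top _)
  have hbW : b ∈ (R'.openCover.f ⟨U, hU⟩) ''ᵁ ⊤ := by
    rw [Scheme.Hom.image_top_eq_opensRange]
    have h3 : b ∈ R'.π ⁻¹ᵁ U := hyU
    rw [R'.π_preimage ⟨U, hU⟩] at h3
    exact h3
  exact isRegularLocalRing_quotient_stalkIdeal_strictTransform_chart R'.π R'.toA1 R' K ⟨U, hU⟩
    (R'.openCover.f ⟨U, hU⟩) (R'.ι_π ⟨U, hU⟩) (R'.ι_toA1 ⟨U, hU⟩) b hbW hbsupp hoff hreg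

/-- **Singular points of the strict transform lie over the support of the Rees algebra or over `singImage K`.**
[cite: Wlodarczyk2022, Def. 2.3.5] -/
theorem singImage_strictTransformPlus_subset {Y : Scheme.{0}} [IsLocallyNoetherian Y]
    (R : ReesAlgebraData Y) (R' : ReesFiltration Y) (hR' : R'.ideal = R.piece)
    [IsLocallyNoetherian R'.cobordantBlowup] (K : Y.IdealSheafData) :
    singImage (R'.strictTransformPlus K) ⊆ R'.πPlus ⁻¹' (R.support ∪ singImage K) := by
  rintro _ ⟨x', rfl, hx'⟩
  by_contra h
  simp only [Set.mem_preimage, Set.mem_union, not_or, ReesAlgebraData.mem_support_iff, not_forall] at h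
  obtain ⟨⟨n, hn, hnot⟩, hreg⟩ := h
  refine hx' (isRegularLocalRing_stalk_strictTransformPlus_of_not_mem R' K x' ⟨n, hn, ?_⟩ hreg)
  rw [hR']
  exact hnot

/-- The same, when the support of the Rees algebra lies inside `singImage K` (e.g. an admissible centre):
`singImage (σˢK) ⊆ σ₊⁻¹ (singImage K)`. [folklore] -/
theorem singImage_strictTransformPlus_subset_of_support_subset {Y : Scheme.{0}} [IsLocallyNoetherian Y]
    (R : ReesAlgebraData Y) (R' : ReesFiltration Y) (hR' : R'.ideal = R.piece)
    [IsLocallyNoetherian R'.cobordantBlowup] (K : Y.IdealSheafData) (hsupp : R.support ⊆ singImage K) :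
    singImage (R'.strictTransformPlus K) ⊆ R'.πPlus ⁻¹' singImage K := by
  refine (singImage_strictTransformPlus_subset R R' hR' K).trans (Set.preimage_mono ?_)
  exact Set.union_subset hsupp le_rfl

/-! ## For stages of the e-ladder -/

namespace Stage

variable {k : Type} [Field k]

/-- For a stage `S` and a regular weighted centre `R` on `S.Y`, the full cobordant blow-up of a Rees filtration
with the pieces of `R` is locally Noetherian (`π` is locally of finite type). [folklore] -/
theorem isLocallyNoetherian_cobordantBlowup (S : Stage k) (R : ReesAlgebraData S.Y)
    (hc : R.IsRegularWeightedCentre) (R' : ReesFiltration S.Y) (hR' : R'.ideal = R.piece) :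
    IsLocallyNoetherian R'.cobordantBlowup := by
  haveI : IsLocallyNoetherian S.Y := LocallyOfFiniteType.isLocallyNoetherian S.f
  haveI := WeightedThesis.GlobalCobordantPlus.locallyOfFiniteType_π R R' hR' hc
  exact LocallyOfFiniteType.isLocallyNoetherian R'.π

/-- **For a stage `S` and a regular weighted centre supported inside `singImage (ker i)`, every singular point of
the strict transform on `B₊` lies over `singImage (ker i)`** — in particular over some maximal singular point of
`S` (`exists_mem_maxSing_of_mem_singImage`). [folklore] -/
theorem πPlus_mem_singImage_of_mem_singImage_succ (S : Stage k) (R : ReesAlgebraData S.Y)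
    (hc : R.IsRegularWeightedCentre) (hsupp : R.support ⊆ singImage S.i.ker)
    (R' : ReesFiltration S.Y) (hR' : R'.ideal = R.piece)
    {x' : (R'.plus : Scheme.{0})} (hx' : x' ∈ singImage (R'.strictTransformPlus S.i.ker)) :
    R'.πPlus x' ∈ singImage S.i.ker := by
  haveI : IsLocallyNoetherian S.Y := LocallyOfFiniteType.isLocallyNoetherian S.f
  haveI := S.isLocallyNoetherian_cobordantBlowup R hc R' hR'
  exact singImage_strictTransformPlus_subset_of_support_subset R R' hR' S.i.ker hsupp hx'

/-- Point form with a maximal singular point downstairs: a singular point of the strict transform specialises,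
after `σ₊`, from a maximal singular point of `S`. [folklore] -/
theorem exists_mem_maxSing_of_mem_singImage_succ (S : Stage k) (R : ReesAlgebraData S.Y)
    (hc : R.IsRegularWeightedCentre) (hsupp : R.support ⊆ singImage S.i.ker)
    (R' : ReesFiltration S.Y) (hR' : R'.ideal = R.piece)
    {x' : (R'.plus : Scheme.{0})} (hx' : x' ∈ singImage (R'.strictTransformPlus S.i.ker)) :
    ∃ η ∈ S.maxSing, R'.πPlus x' ∈ closure ({η} : Set S.Y) :=
  S.exists_mem_maxSing_of_mem_singImage (S.πPlus_mem_singImage_of_mem_singImage_succ R hc hsupp R' hR' hx')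

end Stage

end Summit.ResolutionOfSingularities.ResolutionOfSingularities.Theorems.ELadderOne

end
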